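/-
Copyright: lit-balaban cell, Phase-2 proof seat p11 (gen 4).  Skeleton of a published paper; no claims beyond what the kernel checks.
-/
import Literature.MathematicalPhysics.QuantumFieldTheory.BalabanImbrieJaffe1984to88.BIJ85ScalarFormSemigroup

/-!
# `BalabanImbrieJaffe1984to88.BIJ85PropagatorRG242` — T. Bałaban, J. Imbrie, A. Jaffe, *Renormalization of the Higgs model: minimizers,
propagators and the stability of mean field theory*, Commun. Math. Phys. **97** (1985) 299–329 [BalabanImbrieJaffe1985], Sect. 4.6 p. 313
(*"The other propagators such as C^{(k)}(u_k) are defined as in [3] with the only change that the background gauge field is u_k"*) with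
[3] = T. Bałaban, *(Higgs)₂,₃ quantum fields in a finite volume I*, Commun. Math. Phys. **85** (1982) 603–626 [Balaban1982Higgs1] p. 612,
**the recursive equations of the renormalization group (2.41)/(2.42) — PROVED FOR THE C1 PROPAGATORS `G_k(u_k)`, `C^{(k)}(u_k)` AT EVERY
`U(1)` BACKGROUND on the torus model of record**: `G_{k+1}(u) = (L^d/L²)·[G_k(u) + a_k²G_k(u)Q_k^*(u)C^{(k)}(u)Q_k(u)G_k(u)]` IS the inverse
(4.6.2) at level `k + 1` (two-sided, and every inverse equals it), and `Q_{k+1}(u)G_{k+1}(u) = (L^d/L²)(aa_k/a_{k+1})·Q(u^{(k)})C^{(k)}(u)Q_k(u)G_k(u)`.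

statement-level skeleton of published theorems with citation tags; proofs where landed; nothing here is a claim about the Yang–Mills mass gap

PDF held: `paper:balaban1985-cmp97-bij-higgs-minimizers` (journal page = PDF page + 298), p. 313 [PDF 15]; [3] = `paper:balaban1982-cmp85-higgs23-i`
(journal page = PDF page + 602), pp. 608–612 [PDF 6–10] (`lit read`, this session).

CITATION HEADER (lean-in-tree rule).  Phase-2 file of the lit-balaban TYPED SKELETON (HOME `run/shared/lean/pub/lit-balaban/`), seat p11 gen 4
(unit `lit-balaban-p11-g4`; TAKING line HOME/STATUS.md 2026-08-21T08:18:48Z; owner r15, referee ref-5; own lane = the C1 scalar sector §4.6).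
WHAT IS REPRODUCED: row **C1.Eq4.6.2-4.6.4** (last clause) KNITTED with rows **B1.Eq2.41-2.42** (owner r14) — kind «model-instance».  PRIOR ART IN
THE TREE (cited, not restated): r14's `Balaban1983to89.B1RG242.display241`/`display242` prove (2.41)/(2.42) as MATRIX identities for abstract
`StepData` under invertibility hypotheses (`IsUnit`), and `B1RG242Torus` discharges those hypotheses for the REAL SCALAR tower at `U = 1`; here:
the C1 carriers of record (complex scalar fields, covariant averages `Q_k(u)` with transports, gens 2–4), EVERY background `u`, as identities of
linear maps with the inverses of gen 3 (`exists_GK`) and gen 4 (`BIJ85FluctuationCovariance.exists_C`), the unit-lattice rescaling explicit.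

THE PRINTED TEXT, verbatim.  C1 p. 313 [PDF 15]: *"G_k(u_k) = [−Δ_{u_k} + a_kQ_k^*(u_k)Q_k(u_k)]^{−1}, (4.6.2) … The other propagators such as
C^{(k)}(u_k) are defined as in [3] with the only change that the background gauge field is u_k."*  [3] p. 611 [PDF 9]: *"C^{(k)}(Ω, A) =
(aL^{−2}P(A) + Δ^{(k)}(Ω, A))^{−1}. (2.31)"*; p. 612 [PDF 10]: *"Now we will find recursive relations between the propagators (2.20), (2.30).
Using the relations (2.18), (2.19), (2.21), we get after easy calculations … Q_{k+1}(A)G^ε_{k+1}(Ω, A) = (aa_k/a_{k+1})(L^kε)^{−2}Q(A)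
C^{(k),L^kε}(Ω, A)Q_k(A)G^ε_k(Ω, A), (2.41)  G^ε_{k+1}(Ω, A) = a_k²(L^kε)^{−4}G^ε_k(Ω, A)Q^*_k(A)C^{(k),L^kε}(Ω, A)Q_k(A)G^ε_k(Ω, A) +
G^ε_k(Ω, A). (2.42)  We can treat these identities as recursive equations of the renormalization group. The last two are the most important.
The formula (2.41) allows us to compose the covariances appearing after the successive applications of renormalization transformations."*

NORMALIZATION (as in `BIJ85ScalarFormSemigroup`: the weights (1.5)/(2.2) of [3]/C1 absorbed into the carriers' unweighted `ℓ²` products).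
In the frame where level `j + k` is the unit lattice: `T_k = D^*_{c_k,u}D_{c_k,u} + a_kQ_k^*Q_k`, `c_k² = L^{2k}/L^{kd}` (`cPhys`), the one-step
constant `β = aL^{d−2}` and `C^{(k)}(u) = (βQ(u^{(k)})^*Q(u^{(k)}) + Δ_k(u))^{−1}` (`covOp`, [3]'s `aL^{−2}P` with the weighted adjoint
`Q^{*w} = L^dQ^*`), `QQ^* = L^{−d}` (`Qlin_comp_adjoint`); the printed factors `a_k²(L^kε)^{−4}` and `(aa_k/a_{k+1})(L^kε)^{−2}` become `a_k²`
and `a_k + aL^{−2} = aa_k/a_{k+1}` (`aK_add_eq`), and expressing `G_{k+1}` in ITS unit-lattice frame (`a_{k+1}`, `c_{k+1}`) costs the factor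
`L^d/L²` (`opT_succ_phys`: `T_{k+1} = (L^d/L²)^{−1}·[D^*_{c_k}D_{c_k} + γQ_{k+1}^*Q_{k+1}]`, `γ = (L^d/L²)a_{k+1}` — gen 4's `aK_step`).

WHAT IS PROVED (0 `sorry`, standard axioms; theorems only).
* §1 (abstract finite-dimensional real inner-product spaces) from `T_kG_k = 1` (`hG`), `(βQ′^*Q′ + Δ_k)C = 1` (`hC`), `Q′Q′^* = N^{−1}` (`hQQ`)
  and `γ(αN + β) = αNβ`: **`rg242_apply`** `[D^*D + γ(Q′Q_k)^*(Q′Q_k)](G + α²GQ_k^*CQ_kG) = 1` and **`rg241_apply`**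
  `Q′Q_k(G + α²GQ_k^*CQ_kG) = (α + β/N)·Q′CQ_kG`; two-sidedness and uniqueness of inverses (`leftInverse_of_rightInverse`, `inverse_unique'`,
  Mathlib's `mul_eq_one_comm`); rescaling (`rightInverse_scale`, `opT_scale`).
* §2 torus kernels: the carriers' real inner product (`real_inner_carrier`), **`Qlin_adjoint_eq`** (`Q(W)^* = L^{−d}·` r15's `Cells.QcovStar`),
  `Qlin_comp_adjoint` (`Q(W)Q(W)^* = L^{−d}`), `qlinK_succ_eq_comp` (`Q_{k+1}(u) = Q(u^{(k)})Q_k(u)`), `Dlin_div_smul`.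
* §3 **`rg242_torus`**, **`rg241_torus`**: (2.42)/(2.41) in the level-`k` frame, every `u`, all constants `α, β` (`γ(αL^d + β) = αL^dβ`).
* §4 printed constants (`a_k = BIJ85Sect4Statements.aK`, `cPhys`, `β = aL^d/L²`, `k ≥ 1`, `j + k + 1 ≤ m + K`): **`rg242_phys`**/`rg242_phys_left`
  (two-sided inverse), **`eq_nextG`** (every `G_{k+1}(u)` equals the composed operator), **`rg241_phys`**, and `rg242_phys_exists`
  (hypothesis-free: `G_k(u)`, `C^{(k)}(u)` exist and compose to THE `G_{k+1}(u)`).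
HONEST SCOPE.  (2.39)/(2.40) (normalisation factors `Z`) and (2.43) (the telescoped sum, r14's `B1RG242.display243` abstractly) are not touched;
restricted sets `Ω`, `Λ` of [3] are the whole torus here (C1 is periodic).
-/

open scoped RealInnerProductSpace BigOperators
open Finset

namespace Literature.MathematicalPhysics.QuantumFieldTheory.BalabanImbrieJaffe1984to88.BIJ85PropagatorRG242

open Literature.MathematicalPhysics.QuantumFieldTheory.Balaban1983to89
open BIJ88Sect3Statements (U1 toC cfg covD)
open BIJ85Sect1Model (HiggsField)
open BIJ85BlockAveragesTorus BIJ85BlockAveragesTorusK BIJ85ScalarPropagatorTorus BIJ85ScalarPropagatorTorusK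
open BIJ85ScalarForm464 BIJ85Eq461Proof BIJ85BlockAveragingIneq BIJ85Ineq732Flat BIJ85FluctuationCovariance
open BIJ85FluctuationCovarianceFlatBounds BIJ85ScalarFormSemigroup

noncomputable section

/-! ## §1 Abstract: (2.41)/(2.42) of [3] from `T_kG_k = 1`, `(βQ′^*Q′ + Δ_k)C^{(k)} = 1`, `Q′Q′^* = N^{−1}` -/

section Abstract

variable {Φ Ψ Φ₁ Φ₂ : Type*} [NormedAddCommGroup Φ] [InnerProductSpace ℝ Φ] [NormedAddCommGroup Ψ] [InnerProductSpace ℝ Ψ]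
  [NormedAddCommGroup Φ₁] [InnerProductSpace ℝ Φ₁] [NormedAddCommGroup Φ₂] [InnerProductSpace ℝ Φ₂]
  [FiniteDimensional ℝ Φ] [FiniteDimensional ℝ Ψ] [FiniteDimensional ℝ Φ₁] [FiniteDimensional ℝ Φ₂]

/-- kernel: `D^*D + γ(Q′Q)^*(Q′Q) = [D^*D + αQ^*Q] − αQ^*Q + γQ^*Q′^*Q′Q` pointwise (`adjoint (Q′ ∘ Q) = adjoint Q ∘ adjoint Q′`).
[cite: Balaban1982Higgs1, (2.20) p.610] -/
theorem opT_comp_apply (D : Φ →ₗ[ℝ] Ψ) (Q : Φ →ₗ[ℝ] Φ₁) (Q' : Φ₁ →ₗ[ℝ] Φ₂) (α γ : ℝ) (x : Φ) :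
    opT D (Q' ∘ₗ Q) γ x = opT D Q α x - α • Q.adjoint (Q x) + γ • Q.adjoint (Q'.adjoint (Q' (Q x))) := by
  simp only [opT, LinearMap.add_apply, LinearMap.smul_apply, LinearMap.coe_comp, Function.comp_apply, LinearMap.adjoint_comp]
  abel

/-- kernel: (4.6.4)/(2.21) rearranged, `α²Q_kG_kQ_k^* = α − Δ_k`. [cite: BalabanImbrieJaffe1985, (4.6.4) p.313] -/
theorem sq_smul_QGQadj (Q : Φ →ₗ[ℝ] Φ₁) (α : ℝ) (G : Φ →ₗ[ℝ] Φ) (z : Φ₁) :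
    α ^ 2 • Q (G (Q.adjoint z)) = α • z - deltaOp Q α G z := by
  simp only [deltaOp, LinearMap.sub_apply, LinearMap.smul_apply, LinearMap.id_apply, LinearMap.coe_comp, Function.comp_apply]
  abel

/-- kernel: gen 4's `covOp` pointwise, `(βQ′^*Q′ + Δ_k)w`. [cite: Balaban1982Higgs1, (2.31) p.611] -/
theorem covOp_apply (Q : Φ →ₗ[ℝ] Φ₁) (α : ℝ) (G : Φ →ₗ[ℝ] Φ) (Q' : Φ₁ →ₗ[ℝ] Φ₂) (β : ℝ) (w : Φ₁) :
    covOp Q α G Q' β w = β • Q'.adjoint (Q' w) + deltaOp Q α G w := by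
  simp only [covOp, LinearMap.add_apply, LinearMap.smul_apply, LinearMap.coe_comp, Function.comp_apply]

variable {D : Φ →ₗ[ℝ] Ψ} {Q : Φ →ₗ[ℝ] Φ₁} {Q' : Φ₁ →ₗ[ℝ] Φ₂} {α β γ N : ℝ} {G : Φ →ₗ[ℝ] Φ} {C : Φ₁ →ₗ[ℝ] Φ₁}

/-- **(2.42) of [3], abstract** (*"easy calculations"*, here done): if `T_kG = 1` (`T_k = D^*D + αQ^*Q`), `(βQ′^*Q′ + Δ_k)C = 1`, `Q′Q′^* = N^{−1}`
and `γ(αN + β) = αNβ`, then `G + α²GQ^*CQG` is a right inverse of `T_{k+1} = D^*D + γ(Q′Q)^*(Q′Q)` — by (2.21) in the form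
`α²QGQ^* = α − Δ_k` the correction terms collapse to `(γα + γβ/N − αβ)·Q^*Q′^*Q′CQGφ = 0`. [cite: Balaban1982Higgs1, (2.42) p.612] -/
theorem rg242_apply (hG : ∀ φ, opT D Q α (G φ) = φ) (hC : ∀ ψ, covOp Q α G Q' β (C ψ) = ψ)
    (hQQ : ∀ θ, Q' (Q'.adjoint θ) = N⁻¹ • θ) (hN : N ≠ 0) (hγ : γ * (α * N + β) = α * N * β) (φ : Φ) :
    opT D (Q' ∘ₗ Q) γ (G φ + α ^ 2 • G (Q.adjoint (C (Q (G φ))))) = φ := by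
  set y := C (Q (G φ)) with hy
  have hcov : Q (G φ) = β • Q'.adjoint (Q' y) + deltaOp Q α G y := by rw [← covOp_apply, hy, hC]
  have e1 : opT D (Q' ∘ₗ Q) γ (G φ)
      = φ - (α * β) • Q.adjoint (Q'.adjoint (Q' y)) - α • Q.adjoint (deltaOp Q α G y)
        + (γ * β * N⁻¹) • Q.adjoint (Q'.adjoint (Q' y)) + γ • Q.adjoint (Q'.adjoint (Q' (deltaOp Q α G y))) := by
    rw [opT_comp_apply D Q Q' α γ, hG, hcov]
    simp only [map_add, map_smul, hQQ]
    module
  have e2 : opT D (Q' ∘ₗ Q) γ (α ^ 2 • G (Q.adjoint y))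
      = α ^ 2 • Q.adjoint y - α • (α • Q.adjoint y - Q.adjoint (deltaOp Q α G y))
        + γ • (α • Q.adjoint (Q'.adjoint (Q' y)) - Q.adjoint (Q'.adjoint (Q' (deltaOp Q α G y)))) := by
    rw [opT_comp_apply D Q Q' α γ, map_smul (opT D Q α), hG, map_smul Q (α ^ 2), sq_smul_QGQadj]
    simp only [map_sub, map_smul]
  rw [map_add, e1, e2]
  have hs : γ * α + γ * β * N⁻¹ - α * β = 0 := by
    field_simp
    linear_combination hγ
  have final : φ - (α * β) • Q.adjoint (Q'.adjoint (Q' y)) - α • Q.adjoint (deltaOp Q α G y)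
        + (γ * β * N⁻¹) • Q.adjoint (Q'.adjoint (Q' y)) + γ • Q.adjoint (Q'.adjoint (Q' (deltaOp Q α G y)))
      + (α ^ 2 • Q.adjoint y - α • (α • Q.adjoint y - Q.adjoint (deltaOp Q α G y))
        + γ • (α • Q.adjoint (Q'.adjoint (Q' y)) - Q.adjoint (Q'.adjoint (Q' (deltaOp Q α G y)))))
      = φ + (γ * α + γ * β * N⁻¹ - α * β) • Q.adjoint (Q'.adjoint (Q' y)) := by module
  rw [final, hs, zero_smul, add_zero]

/-- **(2.41) of [3], abstract**: under `(βQ′^*Q′ + Δ_k)C = 1` and `Q′Q′^* = N^{−1}`, `Q′Q(G + α²GQ^*CQG) = (α + β/N)·Q′CQG`.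
[cite: Balaban1982Higgs1, (2.41) p.612] -/
theorem rg241_apply (hC : ∀ ψ, covOp Q α G Q' β (C ψ) = ψ) (hQQ : ∀ θ, Q' (Q'.adjoint θ) = N⁻¹ • θ) (φ : Φ) :
    Q' (Q (G φ + α ^ 2 • G (Q.adjoint (C (Q (G φ)))))) = (α + β * N⁻¹) • Q' (C (Q (G φ))) := by
  set y := C (Q (G φ)) with hy
  have hcov : Q (G φ) = β • Q'.adjoint (Q' y) + deltaOp Q α G y := by rw [← covOp_apply, hy, hC]
  rw [map_add, map_smul, sq_smul_QGQadj, hcov]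
  simp only [map_add, map_sub, map_smul, hQQ]
  module

/-- kernel (finite dimension, Mathlib's `mul_eq_one_comm`): a right inverse of a linear endomorphism is a left inverse — the inverses
(2.20)/(2.30) are two-sided. [cite: Balaban1982Higgs1, (2.20) p.610] -/
theorem leftInverse_of_rightInverse {T G₁ : Φ →ₗ[ℝ] Φ} (h : ∀ φ, T (G₁ φ) = φ) : ∀ φ, G₁ (T φ) = φ := by
  have h1 : T * G₁ = 1 := LinearMap.ext h
  have h2 : G₁ * T = 1 := mul_eq_one_comm.mp h1
  intro φ
  have := LinearMap.congr_fun h2 φ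
  simpa using this

/-- kernel: two right inverses of the same endomorphism coincide (so (2.42) determines `G_{k+1}`). [cite: Balaban1982Higgs1, (2.42) p.612] -/
theorem inverse_unique' {T G₁ G₂ : Φ →ₗ[ℝ] Φ} (h₁ : ∀ φ, T (G₁ φ) = φ) (h₂ : ∀ φ, T (G₂ φ) = φ) : G₁ = G₂ := by
  have l₁ := leftInverse_of_rightInverse h₁
  ext φ
  have := l₁ (G₂ φ)
  rw [h₂] at this
  exact this

omit [FiniteDimensional ℝ Φ] in
/-- kernel (rescaling (2.22) of [3]): if `T′ = t·T` pointwise and `TG₁ = 1` then `T′(t^{−1}G₁) = 1`. [cite: Balaban1982Higgs1, (2.22) p.610] -/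
theorem rightInverse_scale {T T' G₁ : Φ →ₗ[ℝ] Φ} {t : ℝ} (ht : t ≠ 0) (hT' : ∀ x, T' x = t • T x)
    (h : ∀ φ, T (G₁ φ) = φ) (φ : Φ) : T' (t⁻¹ • G₁ φ) = φ := by
  rw [map_smul, hT', h, smul_smul, inv_mul_cancel₀ ht, one_smul]

/-- kernel (rescaling (2.22) of [3] for (4.6.2)): `D′ = s·D` pointwise with `s² = t` gives `D′^*D′ + taQ^*Q = t·(D^*D + aQ^*Q)`.
[cite: Balaban1982Higgs1, (2.22) p.610] -/
theorem opT_scale {D D' : Φ →ₗ[ℝ] Ψ} {s t : ℝ} (hD' : ∀ x, D' x = s • D x) (hs : s ^ 2 = t) (Q₁ : Φ →ₗ[ℝ] Φ₂) (a : ℝ)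
    (x : Φ) : opT D' Q₁ (t * a) x = t • opT D Q₁ a x := by
  have h2 : D'.adjoint (D' x) = (s * s) • D.adjoint (D x) := by
    refine ext_inner_left ℝ fun z => ?_
    rw [LinearMap.adjoint_inner_right, hD', hD', real_inner_smul_left, real_inner_smul_right, real_inner_smul_right,
      LinearMap.adjoint_inner_right, mul_assoc]
  calc opT D' Q₁ (t * a) x = D'.adjoint (D' x) + (t * a) • Q₁.adjoint (Q₁ x) := by
        simp only [opT, LinearMap.add_apply, LinearMap.smul_apply, LinearMap.coe_comp, Function.comp_apply]
    _ = (s * s) • D.adjoint (D x) + (t * a) • Q₁.adjoint (Q₁ x) := by rw [h2]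
    _ = t • (D.adjoint (D x) + a • Q₁.adjoint (Q₁ x)) := by rw [smul_add, smul_smul, ← hs, sq]
    _ = t • opT D Q₁ a x := by
        simp only [opT, LinearMap.add_apply, LinearMap.smul_apply, LinearMap.coe_comp, Function.comp_apply]

end Abstract

/-! ## §2 The torus carriers: `Q(W)Q(W)^† = L^{−d}`, `Q(u^{(k)})Q_k(u) = Q_{k+1}(u)`, the kinetic rescaling -/

variable {P : Params} {i j : ℕ}

/-- kernel: the real scalar product of the carriers (weight-`1` case of (2.2)), `⟨f, g⟩ = Σ_x Re( conj(f(x)) g(x) )`. [cite: BalabanImbrieJaffe1985, (2.2) p.302] -/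
theorem real_inner_carrier {X : Type} [Fintype X] (f g : PiLp 2 (fun _ : X => ℂ)) :
    ⟪f, g⟫ = ∑ x, ((starRingEnd ℂ) (f x) * g x).re := by
  rw [show ⟪f, g⟫ = ∑ x, (g x * (starRingEnd ℂ) (f x)).re from rfl]
  exact sum_congr rfl fun x _ => by rw [mul_comm]

/-- **`Q(W)^*` for the carriers' products** (every transport field `W`): the adjoint of `Qlin W` is `L^{−d}·`(r15's `Cells.QcovStar` on r18's
`torusCells`), i.e. `(Q(W)^*θ)(x) = L^{−d}conj(w(Γ_{yx}))θ(y)` — *"Q^* is the adjoint in the scalar product (2.2)"* read with weight `1` on both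
lattices (the printed weighted adjoint is `L^d` times this one). [cite: BalabanImbrieJaffe1985, (2.9) p.303] -/
theorem Qlin_adjoint_eq (W : GaugeField P i U1) (θ : CoarseSp P i) :
    (Qlin W).adjoint θ
      = ((P.L : ℝ) ^ P.d)⁻¹ • (WithLp.toLp 2 ((torusCells P i).QcovStar (holCircle W) (WithLp.ofLp θ)) : FineSp P i) := by
  set E : FineSp P i := WithLp.toLp 2 ((torusCells P i).QcovStar (holCircle W) (WithLp.ofLp θ)) with hE
  refine ext_inner_right ℝ fun φ => ?_
  rw [LinearMap.adjoint_inner_left, real_inner_smul_left, real_inner_carrier, real_inner_carrier,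
    ← sum_fiberwise univ (fun x : Balaban1983to89.Site P i => blockOf x) (fun x => ((starRingEnd ℂ) (E x) * φ x).re), mul_sum]
  refine sum_congr rfl fun y _ => ?_
  have h : ∀ x ∈ block y, ((starRingEnd ℂ) (E x) * φ x).re = (holC W x * (starRingEnd ℂ) (θ y) * φ x).re := by
    intro x hx
    rw [mem_block_iff] at hx
    rw [show E x = (starRingEnd ℂ) (holC W x) * θ (blockOf x) from qCovStar_apply W _ x, hx, map_mul, Complex.conj_conj]
  show _ = ((P.L : ℝ) ^ P.d)⁻¹ * ∑ x ∈ block y, ((starRingEnd ℂ) (E x) * φ x).re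
  rw [sum_congr rfl h, Qlin_apply, qCov_apply]
  have e1 : (starRingEnd ℂ) (θ y) * (((P.L : ℂ) ^ P.d)⁻¹ * ∑ x ∈ block y, holC W x * (WithLp.ofLp φ) x)
      = ((((P.L : ℝ) ^ P.d)⁻¹ : ℝ) : ℂ) * ∑ x ∈ block y, holC W x * (starRingEnd ℂ) (θ y) * φ x := by
    rw [mul_sum, mul_sum, mul_sum]
    push_cast
    exact sum_congr rfl fun x _ => by ring
  rw [e1, Complex.re_ofReal_mul, Complex.re_sum]

/-- **(2.9) `QQ^* = I` in the carriers' products: `Q(W)Q(W)^* = L^{−d}·1`** (standing range), from `Qlin_adjoint_eq` and gen 4's `qlin_qCovStar`.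
[cite: BalabanImbrieJaffe1985, (2.9) p.303] -/
theorem Qlin_comp_adjoint (hi : i + 1 ≤ P.m + P.K) (W : GaugeField P i U1) (θ : CoarseSp P i) :
    Qlin W ((Qlin W).adjoint θ) = ((P.L : ℝ) ^ P.d)⁻¹ • θ := by
  rw [Qlin_adjoint_eq, map_smul, qlin_qCovStar hi]

/-- kernel: `Q_{k+1}(u) = Q(u^{(k)}) ∘ Q_k(u)` as linear maps (gen 3's `qCovK_succ`, definitional). [cite: BalabanImbrieJaffe1985, (4.6.4) p.313] -/
theorem qlinK_succ_eq_comp (U : GaugeField P j U1) (k : ℕ) :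
    QlinK U (k+1) = (Qlin (lineIter U k) : CoarseSpK P j k →ₗ[ℝ] CoarseSpK P j (k+1)) ∘ₗ QlinK U k :=
  LinearMap.ext fun φ => (qlin_qlinK U k φ).symm

/-- kernel: `D_{c₁,u} = (c₁/c)·D_{c,u}` (`c ≠ 0`) — the kinetic normalization is a scalar. [cite: BalabanImbrieJaffe1985, (4.6.3) p.313] -/
theorem Dlin_div_smul {c : ℝ} (hc : c ≠ 0) (c₁ : ℝ) (U : GaugeField P j U1) (φ : FineSp P j) :
    Dlin c₁ U φ = (c₁ / c) • Dlin c U φ := by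
  have hc' : (c : ℂ) ≠ 0 := Complex.ofReal_ne_zero.2 hc
  ext b
  rw [PiLp.smul_apply, Dlin_apply, Dlin_apply, Complex.real_smul]
  simp only [covD]
  rw [← mul_assoc]
  congr 1
  push_cast
  rw [div_mul_cancel₀ _ hc']

/-! ## §3 (2.41)/(2.42) for the C1 propagators at every background -/

/-- **(2.42) of [3] FOR `G_k(u)` ON THE TORUS, EVERY background, level-`k` frame**: for every `u`, `k` with `j + k + 1 ≤ m + K`, constants with
`γ(αL^d + β) = αL^dβ`, `G` the inverse (4.6.2) at `(c, Q_k(u), α)` and `C` the covariance `(βQ(u^{(k)})^*Q(u^{(k)}) + Δ_k(u))^{−1}` (gen 4 `exists_C`):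
`[D^*_{c,u}D_{c,u} + γQ_{k+1}(u)^*Q_{k+1}(u)](G + α²GQ_k^*CQ_kG) = 1`. [cite: Balaban1982Higgs1, (2.42) p.612] -/
theorem rg242_torus {k : ℕ} (hk : j + k + 1 ≤ P.m + P.K) (U : GaugeField P j U1) {c α β γ : ℝ}
    (hγ : γ * (α * (P.L : ℝ) ^ P.d + β) = α * (P.L : ℝ) ^ P.d * β)
    {G : FineSp P j →ₗ[ℝ] FineSp P j} (hG : ∀ φ, opT (Dlin c U) (QlinK U k) α (G φ) = φ)
    {C : CoarseSpK P j k →ₗ[ℝ] CoarseSpK P j k} (hC : ∀ ψ, covOp (QlinK U k) α G (Qlin (lineIter U k)) β (C ψ) = ψ)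
    (φ : FineSp P j) :
    opT (Dlin c U) (QlinK U (k+1)) γ (G φ + α ^ 2 • G ((QlinK U k).adjoint (C (QlinK U k (G φ))))) = φ := by
  have hN : ((P.L : ℝ) ^ P.d) ≠ 0 := by have := three_le_L P; positivity
  rw [qlinK_succ_eq_comp]
  exact rg242_apply hG hC (fun θ => Qlin_comp_adjoint (i := j + k) hk (lineIter U k) θ) hN hγ φ

/-- **(2.41) of [3] ON THE TORUS, EVERY background, level-`k` frame**: `Q_{k+1}(u)(G + α²GQ_k^*CQ_kG) = (α + βL^{−d})·Q(u^{(k)})CQ_k(u)G`.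
[cite: Balaban1982Higgs1, (2.41) p.612] -/
theorem rg241_torus {k : ℕ} (hk : j + k + 1 ≤ P.m + P.K) (U : GaugeField P j U1) {α β : ℝ}
    {G : FineSp P j →ₗ[ℝ] FineSp P j}
    {C : CoarseSpK P j k →ₗ[ℝ] CoarseSpK P j k} (hC : ∀ ψ, covOp (QlinK U k) α G (Qlin (lineIter U k)) β (C ψ) = ψ)
    (φ : FineSp P j) :
    QlinK U (k+1) (G φ + α ^ 2 • G ((QlinK U k).adjoint (C (QlinK U k (G φ)))))
      = (α + β * ((P.L : ℝ) ^ P.d)⁻¹) • Qlin (lineIter U k) (C (QlinK U k (G φ))) := by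
  rw [← qlin_qlinK]
  exact rg241_apply hC (fun θ => Qlin_comp_adjoint (i := j + k) hk (lineIter U k) θ) φ

/-! ## §4 The printed constants and the rescaling to the next unit lattice -/

/-- kernel: the scalar of (2.41), `a_k + aL^{−2} = aa_k/a_{k+1}` for r15's printed `a_k` ((2.13)/(2.15) of [3]; gen 2's `aK_succ_eq`), `k ≥ 1`.
[cite: Balaban1982Higgs1, (2.41) p.612] -/
theorem aK_add_eq {a L : ℝ} (ha : 0 < a) (hL : 1 < L) {k : ℕ} (hk : 1 ≤ k) :
    BIJ85Sect4Statements.aK a L k + a * (L ^ 2)⁻¹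
      = a * BIJ85Sect4Statements.aK a L k / BIJ85Sect4Statements.aK a L (k+1) := by
  have haK := (BIJ85CoefficientAk464.aK_pos_le ha hL hk).1
  have hL0 : (0 : ℝ) < L := by linarith
  rw [BIJ85CoefficientAk464.aK_succ_eq ha hL hk]
  field_simp
  ring

/-- kernel: the composed operator `G + a_k²GQ_k^*CQ_kG` pointwise. [cite: Balaban1982Higgs1, (2.42) p.612] -/
theorem nextG_apply {k : ℕ} (U : GaugeField P j U1) (α : ℝ) (G : FineSp P j →ₗ[ℝ] FineSp P j)
    (C : CoarseSpK P j k →ₗ[ℝ] CoarseSpK P j k) (φ : FineSp P j) :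
    (G + α ^ 2 • (G ∘ₗ (QlinK U k).adjoint ∘ₗ C ∘ₗ QlinK U k ∘ₗ G)) φ
      = G φ + α ^ 2 • G ((QlinK U k).adjoint (C (QlinK U k (G φ)))) := by
  simp only [LinearMap.smul_apply, LinearMap.add_apply, LinearMap.coe_comp, Function.comp_apply]

/-- kernel (the rescaling to the next unit lattice): at the printed constants, `T_{k+1} = D^*_{c_{k+1},u}D_{c_{k+1},u} + a_{k+1}Q_{k+1}^*Q_{k+1}` is
`(L^d/L²)^{−1}` times the level-`k`-frame operator `D^*_{c_k,u}D_{c_k,u} + γQ_{k+1}^*Q_{k+1}`, `γ = a_kL^d·aL^{d−2}/(a_kL^d + aL^{d−2})` (gen 4's `aK_step`,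
`cPhys_step`). [cite: Balaban1982Higgs1, (2.22) p.610] -/
theorem opT_succ_phys {k : ℕ} (hk1 : 1 ≤ k) (U : GaugeField P j U1) {a : ℝ} (ha : 0 < a) (x : FineSp P j) :
    opT (Dlin (cPhys P (k+1)) U) (QlinK U (k+1)) (BIJ85Sect4Statements.aK a P.L (k+1)) x
      = ((P.L : ℝ) ^ P.d / (P.L : ℝ) ^ 2)⁻¹ • opT (Dlin (cPhys P k) U) (QlinK U (k+1))
          (BIJ85Sect4Statements.aK a P.L k * (P.L : ℝ) ^ P.d * (a * ((P.L : ℝ) ^ P.d / (P.L : ℝ) ^ 2))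
            / (BIJ85Sect4Statements.aK a P.L k * (P.L : ℝ) ^ P.d + a * ((P.L : ℝ) ^ P.d / (P.L : ℝ) ^ 2))) x := by
  have hL0 : (0 : ℝ) < P.L := by linarith [three_le_L P]
  have hs : (cPhys P (k+1) / cPhys P k) ^ 2 = ((P.L : ℝ) ^ P.d / (P.L : ℝ) ^ 2)⁻¹ := by
    rw [div_pow, cPhys_step, mul_div_assoc, div_self (pow_ne_zero _ (cPhys_pos P k).ne'), mul_one]
  rw [aK_step ha P hk1]
  exact opT_scale (fun x => Dlin_div_smul (cPhys_pos P k).ne' _ U x) hs _ _ x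

/-- **(2.42) of [3] FOR THE C1 PROPAGATORS WITH THE PRINTED CONSTANTS, EVERY `U(1)` BACKGROUND**: for `k ≥ 1`, `j + k + 1 ≤ m + K`, `a > 0`, every
`u`, `G = G_k(u)` the inverse (4.6.2) at `(cPhys k, a_k)` and `C = C^{(k)}(u)` the inverse of `aL^{d−2}Q(u^{(k)})^*Q(u^{(k)}) + Δ_k(u)` ([3] (2.31) with
background `u_k`): **`G_{k+1}(u) := (L^d/L²)·[G + a_k²GQ_k(u)^*CQ_k(u)G]` is a right inverse of `D^*_{c_{k+1},u}D_{c_{k+1},u} + a_{k+1}Q_{k+1}(u)^*Q_{k+1}(u)`**.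
[cite: Balaban1982Higgs1, (2.42) p.612] -/
theorem rg242_phys {k : ℕ} (hk1 : 1 ≤ k) (hk : j + k + 1 ≤ P.m + P.K) (U : GaugeField P j U1) {a : ℝ} (ha : 0 < a)
    {G : FineSp P j →ₗ[ℝ] FineSp P j}
    (hG : ∀ φ, opT (Dlin (cPhys P k) U) (QlinK U k) (BIJ85Sect4Statements.aK a P.L k) (G φ) = φ)
    {C : CoarseSpK P j k →ₗ[ℝ] CoarseSpK P j k}
    (hC : ∀ ψ, covOp (QlinK U k) (BIJ85Sect4Statements.aK a P.L k) G (Qlin (lineIter U k))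
      (a * ((P.L : ℝ) ^ P.d / (P.L : ℝ) ^ 2)) (C ψ) = ψ) (φ : FineSp P j) :
    opT (Dlin (cPhys P (k+1)) U) (QlinK U (k+1)) (BIJ85Sect4Statements.aK a P.L (k+1))
      ((((P.L : ℝ) ^ P.d / (P.L : ℝ) ^ 2) • (G + BIJ85Sect4Statements.aK a P.L k ^ 2
          • (G ∘ₗ (QlinK U k).adjoint ∘ₗ C ∘ₗ QlinK U k ∘ₗ G))) φ) = φ := by
  have hL : (1 : ℝ) < P.L := by linarith [three_le_L P]
  have hr : (0 : ℝ) < (P.L : ℝ) ^ P.d / (P.L : ℝ) ^ 2 := by positivity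
  have hαN : BIJ85Sect4Statements.aK a P.L k * (P.L : ℝ) ^ P.d + a * ((P.L : ℝ) ^ P.d / (P.L : ℝ) ^ 2) ≠ 0 := by
    have := (BIJ85CoefficientAk464.aK_pos_le ha hL hk1).1
    positivity
  have hγ := div_mul_cancel₀ (BIJ85Sect4Statements.aK a P.L k * (P.L : ℝ) ^ P.d * (a * ((P.L : ℝ) ^ P.d / (P.L : ℝ) ^ 2))) hαN
  have h0 : ∀ φ, opT (Dlin (cPhys P k) U) (QlinK U (k+1))
      (BIJ85Sect4Statements.aK a P.L k * (P.L : ℝ) ^ P.d * (a * ((P.L : ℝ) ^ P.d / (P.L : ℝ) ^ 2))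
        / (BIJ85Sect4Statements.aK a P.L k * (P.L : ℝ) ^ P.d + a * ((P.L : ℝ) ^ P.d / (P.L : ℝ) ^ 2)))
      ((G + BIJ85Sect4Statements.aK a P.L k ^ 2 • (G ∘ₗ (QlinK U k).adjoint ∘ₗ C ∘ₗ QlinK U k ∘ₗ G)) φ) = φ := fun φ => by
    rw [nextG_apply]
    exact rg242_torus hk U hγ hG hC φ
  have h := rightInverse_scale (T' := opT (Dlin (cPhys P (k+1)) U) (QlinK U (k+1)) (BIJ85Sect4Statements.aK a P.L (k+1)))
    (inv_ne_zero hr.ne') (opT_succ_phys hk1 U ha) h0 φ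
  rw [inv_inv] at h
  rw [LinearMap.smul_apply]
  exact h

/-- **… and a left inverse** (two-sided: `G_{k+1}(u)` IS the propagator (4.6.2) at level `k + 1`). [cite: Balaban1982Higgs1, (2.42) p.612] -/
theorem rg242_phys_left {k : ℕ} (hk1 : 1 ≤ k) (hk : j + k + 1 ≤ P.m + P.K) (U : GaugeField P j U1) {a : ℝ} (ha : 0 < a)
    {G : FineSp P j →ₗ[ℝ] FineSp P j}
    (hG : ∀ φ, opT (Dlin (cPhys P k) U) (QlinK U k) (BIJ85Sect4Statements.aK a P.L k) (G φ) = φ)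
    {C : CoarseSpK P j k →ₗ[ℝ] CoarseSpK P j k}
    (hC : ∀ ψ, covOp (QlinK U k) (BIJ85Sect4Statements.aK a P.L k) G (Qlin (lineIter U k))
      (a * ((P.L : ℝ) ^ P.d / (P.L : ℝ) ^ 2)) (C ψ) = ψ) (φ : FineSp P j) :
    (((P.L : ℝ) ^ P.d / (P.L : ℝ) ^ 2) • (G + BIJ85Sect4Statements.aK a P.L k ^ 2
          • (G ∘ₗ (QlinK U k).adjoint ∘ₗ C ∘ₗ QlinK U k ∘ₗ G)))
      (opT (Dlin (cPhys P (k+1)) U) (QlinK U (k+1)) (BIJ85Sect4Statements.aK a P.L (k+1)) φ) = φ :=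
  leftInverse_of_rightInverse (rg242_phys hk1 hk U ha hG hC) φ

/-- **(2.42) AS AN EQUATION FOR THE PROPAGATOR**: every right inverse `G_{k+1}(u)` of `D^*_{c_{k+1},u}D_{c_{k+1},u} + a_{k+1}Q_{k+1}^*Q_{k+1}` (gen 3's
`exists_GK` provides THE one) EQUALS `(L^d/L²)·[G_k + a_k²G_kQ_k^*C^{(k)}Q_kG_k]`. [cite: Balaban1982Higgs1, (2.42) p.612] -/
theorem eq_nextG {k : ℕ} (hk1 : 1 ≤ k) (hk : j + k + 1 ≤ P.m + P.K) (U : GaugeField P j U1) {a : ℝ} (ha : 0 < a)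
    {G : FineSp P j →ₗ[ℝ] FineSp P j}
    (hG : ∀ φ, opT (Dlin (cPhys P k) U) (QlinK U k) (BIJ85Sect4Statements.aK a P.L k) (G φ) = φ)
    {C : CoarseSpK P j k →ₗ[ℝ] CoarseSpK P j k}
    (hC : ∀ ψ, covOp (QlinK U k) (BIJ85Sect4Statements.aK a P.L k) G (Qlin (lineIter U k))
      (a * ((P.L : ℝ) ^ P.d / (P.L : ℝ) ^ 2)) (C ψ) = ψ)
    {G₁ : FineSp P j →ₗ[ℝ] FineSp P j}
    (hG₁ : ∀ φ, opT (Dlin (cPhys P (k+1)) U) (QlinK U (k+1)) (BIJ85Sect4Statements.aK a P.L (k+1)) (G₁ φ) = φ) :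
    G₁ = ((P.L : ℝ) ^ P.d / (P.L : ℝ) ^ 2) • (G + BIJ85Sect4Statements.aK a P.L k ^ 2
          • (G ∘ₗ (QlinK U k).adjoint ∘ₗ C ∘ₗ QlinK U k ∘ₗ G)) :=
  inverse_unique' hG₁ (rg242_phys hk1 hk U ha hG hC)

/-- **(2.41) of [3] WITH THE PRINTED CONSTANTS, EVERY `U(1)` BACKGROUND**: `Q_{k+1}(u)G_{k+1}(u) = (L^d/L²)(aa_k/a_{k+1})·Q(u^{(k)})C^{(k)}(u)Q_k(u)G_k(u)`
— *"allows us to compose the covariances appearing after the successive applications of renormalization transformations"*.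
[cite: Balaban1982Higgs1, (2.41) p.612] -/
theorem rg241_phys {k : ℕ} (hk1 : 1 ≤ k) (hk : j + k + 1 ≤ P.m + P.K) (U : GaugeField P j U1) {a : ℝ} (ha : 0 < a)
    (G : FineSp P j →ₗ[ℝ] FineSp P j) {C : CoarseSpK P j k →ₗ[ℝ] CoarseSpK P j k}
    (hC : ∀ ψ, covOp (QlinK U k) (BIJ85Sect4Statements.aK a P.L k) G (Qlin (lineIter U k))
      (a * ((P.L : ℝ) ^ P.d / (P.L : ℝ) ^ 2)) (C ψ) = ψ) (φ : FineSp P j) :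
    QlinK U (k+1) ((((P.L : ℝ) ^ P.d / (P.L : ℝ) ^ 2) • (G + BIJ85Sect4Statements.aK a P.L k ^ 2
          • (G ∘ₗ (QlinK U k).adjoint ∘ₗ C ∘ₗ QlinK U k ∘ₗ G))) φ)
      = ((P.L : ℝ) ^ P.d / (P.L : ℝ) ^ 2 * (a * BIJ85Sect4Statements.aK a P.L k / BIJ85Sect4Statements.aK a P.L (k+1)))
          • Qlin (lineIter U k) (C (QlinK U k (G φ))) := by
  have hL : (1 : ℝ) < P.L := by linarith [three_le_L P]
  have hL0 : (0 : ℝ) < P.L := by linarith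
  rw [LinearMap.smul_apply, nextG_apply, map_smul, rg241_torus hk U hC, smul_smul, ← aK_add_eq ha hL hk1]
  congr 1
  field_simp

/-- **COROLLARY, hypothesis-free**: for every `u`, `a > 0`, `k ≥ 1`, `j + k + 1 ≤ m + K` THE inverse `G_k(u)` of (4.6.2) (gen 3 `exists_GK`) and THE
covariance `C^{(k)}(u)` (gen 4 `exists_C`, *"C^{(k)}(u_k) … defined as in [3]"*) exist, and the composed operator is a two-sided inverse at level
`k + 1` — (2.42) holds for the C1 propagators with background `u_k` replaced by any `u`. [cite: BalabanImbrieJaffe1985, (4.6.2) p.313] -/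
theorem rg242_phys_exists {k : ℕ} (hk1 : 1 ≤ k) (hk : j + k + 1 ≤ P.m + P.K) (U : GaugeField P j U1) {a : ℝ} (ha : 0 < a) :
    ∃ (G : FineSp P j →ₗ[ℝ] FineSp P j) (C : CoarseSpK P j k →ₗ[ℝ] CoarseSpK P j k),
      (∀ φ, opT (Dlin (cPhys P k) U) (QlinK U k) (BIJ85Sect4Statements.aK a P.L k) (G φ) = φ) ∧
      (∀ ψ, covOp (QlinK U k) (BIJ85Sect4Statements.aK a P.L k) G (Qlin (lineIter U k))
        (a * ((P.L : ℝ) ^ P.d / (P.L : ℝ) ^ 2)) (C ψ) = ψ) ∧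
      (∀ φ, opT (Dlin (cPhys P (k+1)) U) (QlinK U (k+1)) (BIJ85Sect4Statements.aK a P.L (k+1))
        ((((P.L : ℝ) ^ P.d / (P.L : ℝ) ^ 2) • (G + BIJ85Sect4Statements.aK a P.L k ^ 2
          • (G ∘ₗ (QlinK U k).adjoint ∘ₗ C ∘ₗ QlinK U k ∘ₗ G))) φ) = φ) ∧
      (∀ φ, (((P.L : ℝ) ^ P.d / (P.L : ℝ) ^ 2) • (G + BIJ85Sect4Statements.aK a P.L k ^ 2
          • (G ∘ₗ (QlinK U k).adjoint ∘ₗ C ∘ₗ QlinK U k ∘ₗ G)))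
        (opT (Dlin (cPhys P (k+1)) U) (QlinK U (k+1)) (BIJ85Sect4Statements.aK a P.L (k+1)) φ) = φ) := by
  have hL : (1 : ℝ) < P.L := by linarith [three_le_L P]
  have hr : (0 : ℝ) < (P.L : ℝ) ^ P.d / (P.L : ℝ) ^ 2 := by positivity
  have hα := (BIJ85CoefficientAk464.aK_pos_le ha hL hk1).1
  obtain ⟨G, hG, -⟩ := exists_GK (k := k) (by omega) (cPhys_pos P k).ne' hα U
  obtain ⟨C, hC, -⟩ := exists_C hk (cPhys_pos P k).ne' hα (mul_pos ha hr) U hG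
  exact ⟨G, C, hG, hC, rg242_phys hk1 hk U ha hG hC, rg242_phys_left hk1 hk U ha hG hC⟩

end

end Literature.MathematicalPhysics.QuantumFieldTheory.BalabanImbrieJaffe1984to88.BIJ85PropagatorRG242
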